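import Summits.ResolutionOfSingularities.ResolutionOfSingularities.Theorems.RisoStrataDescentAlgclosedToPerfectBlowupDescent
import Literature.AlgebraicGeometry.Resolution.ComponentGluing

/-!
# `RisoStrata.DescentAlgclosedToPerfect` (stmt-ResolutionOfSingularities-0550): the crux reduces to the
# existence of RATIONAL resolving ideals

Route `ResolutionOfSingularities/RisoStrata` (crux shared verbatim with six other routes). A machine-checked
statement of what is left of the crux once the action-free half of Galois descent is in place
(`hasResolution_of_isBlowup_comap_fieldExtension`, this seat's
`Theorems/RisoStrataDescentAlgclosedToPerfectBlowupDescent.lean`):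

* `descentAlgclosedToPerfect_of_rationalResolvingIdeal` — **the crux follows from**: for every prime `p`
  such that resolution holds over all algebraically closed fields of characteristic `p` (the antecedent of
  the crux, verbatim), every INTEGRAL separated scheme `X` of finite type over a PERFECT field `k` of
  characteristic `p` admits, after SOME extension of fields `σ : k → K`, a resolution of `X ×_k K` which
  is the blow-up of a non-zero ideal sheaf PULLED BACK FROM `X` ("a `k`-rational resolving ideal").
  Proof: reduced ⇒ integral by resolving the finitely many integral closed subschemes and gluing
  (`ComponentGluing.hasResolution_of_forall_closeds`, proved in tree), then the blow-up of `X` along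
  the rational ideal is a resolution (`hasResolution_of_isBlowup_comap_fieldExtension`).
* `rationalResolvingIdeal_iff_exists_regular_blowup` — sanity form of the hypothesis for ONE `X`: a
  rational resolving ideal over some `K ⊇ k` exists iff `X` itself has a non-zero ideal sheaf with
  regular blow-up (take `K = k`; conversely base-change the blow-up of `X`), i.e. the field extension in
  the hypothesis is only there to be fed by the antecedent — the content of the crux is to make ONE
  resolving ideal over `k̄` Galois-invariant (Kollár 2007, 3.34.2; BGMW 2011, Remark p. 23), which bare
  existence does not provide.
-/

noncomputable section

set_option linter.dupNamespace false -- mandated namespace of this single-conjunct summit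

open CategoryTheory CategoryTheory.Limits AlgebraicGeometry
open Literature.AlgebraicGeometry.Resolution

namespace Summit.ResolutionOfSingularities.ResolutionOfSingularities.Theorems

/-- **Crux `DescentAlgclosedToPerfect` from rational resolving ideals.** Suppose that for every prime
`p` for which every reduced separated scheme of finite type over every algebraically closed field of
characteristic `p` has a resolution, every integral separated scheme `X` of finite type over a perfect
field `k` of characteristic `p` admits an extension of fields `σ : k → K`, a non-zero ideal sheaf `J`
on `X` and a REGULAR blow-up of `X ×_k K` along `J·𝒪_{X_K}`. Then `DescentAlgclosedToPerfect` holds: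
reduce to integral `X` (resolve the integral closed subschemes and glue, `ComponentGluing`), and descend
the blow-up (`hasResolution_of_isBlowup_comap_fieldExtension`: `Bl_J X ×_k K ≅ Bl_{J𝒪} X_K` is regular,
regularity descends along the flat surjection `Bl_J X ×_k K → Bl_J X`, and `Bl_J X → X` is proper
birational). [cite: Kollar2007, 3.34.2 p. 131 and Thm. 3.36; GortzWedhorn2020, Prop. 13.91 (2)] -/
theorem descentAlgclosedToPerfect_of_rationalResolvingIdeal
    (H : ∀ p : ℕ, p.Prime →
      (∀ (k : Type) [Field k] [CharP k p] [IsAlgClosed k] (X : Scheme.{0})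
        (f : X ⟶ Spec (.of k)), IsSeparated f → LocallyOfFiniteType f → QuasiCompact f →
        IsReduced X → Scheme.HasResolution X) →
      ∀ (k : Type) [Field k] [CharP k p] [PerfectField k] (X : Scheme.{0}) (f : X ⟶ Spec (.of k)),
        IsSeparated f → LocallyOfFiniteType f → QuasiCompact f → IsIntegral X →
        ∃ (K : Type) (_ : Field K) (σ : k →+* K) (J : X.IdealSheafData) (Y : Scheme.{0})
          (ρ : Y ⟶ pullback f (Spec.map (CommRingCat.ofHom σ))),
          J ≠ ⊥ ∧ IsBlowup ρ (J.comap (pullback.fst f (Spec.map (CommRingCat.ofHom σ)))) ∧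
            Scheme.IsRegular Y) :
    Summit.ResolutionOfSingularities.ResolutionOfSingularities.Theses.RisoStrata.DescentAlgclosedToPerfect := by
  intro p hp hA k _ _ _ X f hs hl hq hr
  refine ComponentGluing.hasResolution_of_forall_closeds X f fun Z hZ => ?_
  haveI := hZ
  obtain ⟨K, _, σ, J, Y, ρ, hJ, hρ, hY⟩ :=
    H p hp hA k _ ((Scheme.IdealSheafData.vanishingIdeal Z).subschemeι ≫ f) inferInstance
      inferInstance inferInstance hZ
  haveI : IsLocallyNoetherian (Scheme.IdealSheafData.vanishingIdeal Z).subscheme :=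
    LocallyOfFiniteType.isLocallyNoetherian ((Scheme.IdealSheafData.vanishingIdeal Z).subschemeι ≫ f)
  exact hasResolution_of_isBlowup_comap_fieldExtension σ _ hJ hρ hY

/-- **The field extension in a rational resolving ideal is inessential for a single `X`**: an integral
locally Noetherian `X` over `k` admits, over SOME extension `K ⊇ k`, a regular blow-up of `X_K` along an
ideal pulled back from `X` iff `X` has a non-zero ideal sheaf whose own blow-up is regular (`K = k`:
`X ×_k k → X` is an isomorphism, i.e. flat, surjective and a blow-up base change; conversely descend with
`hasResolution_of_isBlowup_comap`-style flat descent of regularity). So the hypothesis of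
`descentAlgclosedToPerfect_of_rationalResolvingIdeal` asks the antecedent (resolution over `k̄`) to
produce a resolving ideal of `X_{k̄}` that is DEFINED OVER `k` — for `k̄/k` Galois, a Galois-invariant
one. [cite: Kollar2007, 3.34.2 p. 131; GortzWedhorn2020, Prop. 13.91 (2)] -/
theorem rationalResolvingIdeal_iff_exists_regular_blowup {k : Type} [Field k] {X : Scheme.{0}}
    (f : X ⟶ Spec (.of k)) [IsIntegral X] [IsLocallyNoetherian X] :
    (∃ (K : Type) (_ : Field K) (σ : k →+* K) (J : X.IdealSheafData) (Y : Scheme.{0})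
        (ρ : Y ⟶ pullback f (Spec.map (CommRingCat.ofHom σ))),
        J ≠ ⊥ ∧ IsBlowup ρ (J.comap (pullback.fst f (Spec.map (CommRingCat.ofHom σ)))) ∧
          Scheme.IsRegular Y) ↔
      ∃ (J : X.IdealSheafData) (X' : Scheme.{0}) (π : X' ⟶ X),
        J ≠ ⊥ ∧ IsBlowup π J ∧ Scheme.IsRegular X' := by
  constructor
  · rintro ⟨K, _, σ, J, Y, ρ, hJ, hρ, hY⟩
    -- descend: the blow-up of `X` along `J` is regular
    obtain ⟨X', π, hπ⟩ := exists_isBlowup X J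
    set ι := pullback.fst f (Spec.map (CommRingCat.ofHom σ)) with hι
    haveI : Flat (Spec.map (CommRingCat.ofHom σ)) := DeJong1996.Stage.flat_specMap σ
    haveI : Surjective (Spec.map (CommRingCat.ofHom σ)) := DeJong1996.Stage.surjective_specMap σ
    haveI : Flat ι := MorphismProperty.pullback_fst _ _ ‹_›
    haveI : Surjective ι := MorphismProperty.pullback_fst _ _ ‹_›
    have hbc : IsBlowup (pullback.snd π ι) (J.comap ι) := hπ.pullback_snd_of_flat ι
    obtain ⟨e, -, -⟩ := hρ.unique hbc
    have hP : Scheme.IsRegular (pullback π ι) := hY.of_iso e.hom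
    haveI : IsProper π := stacks02NS_holds.of_isLocallyNoetherian π J hπ
    haveI : IsLocallyNoetherian X' := LocallyOfFiniteType.isLocallyNoetherian π
    haveI : Flat (pullback.fst π ι) := MorphismProperty.pullback_fst _ _ ‹Flat ι›
    haveI : Surjective (pullback.fst π ι) := MorphismProperty.pullback_fst _ _ ‹Surjective ι›
    exact ⟨J, X', π, hJ, hπ, DeJong1996.Stage.isRegular_of_flat_surjective (pullback.fst π ι) hP⟩
  · rintro ⟨J, X', π, hJ, hπ, hX'⟩
    -- take `K = k`: the base change of `π` along `X ×_k k → X` is a blow-up along `J·𝒪`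
    let σ := RingHom.id k
    set ι := pullback.fst f (Spec.map (CommRingCat.ofHom σ)) with hι
    haveI : Flat (Spec.map (CommRingCat.ofHom σ)) := DeJong1996.Stage.flat_specMap σ
    haveI : Flat ι := MorphismProperty.pullback_fst _ _ ‹_›
    refine ⟨k, inferInstance, σ, J, pullback π ι, pullback.snd π ι, hJ, hπ.pullback_snd_of_flat ι, ?_⟩
    -- `ι` is an isomorphism (base change of `Spec k → Spec k`), hence so is `pullback.fst π ι`
    haveI : IsIso (Spec.map (CommRingCat.ofHom σ)) := by
      rw [show CommRingCat.ofHom σ = 𝟙 (CommRingCat.of k) from rfl, Spec.map_id]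
      infer_instance
    haveI : IsIso ι := MorphismProperty.pullback_fst (P := MorphismProperty.isomorphisms Scheme) _ _ ‹_›
    haveI : IsIso (pullback.fst π ι) :=
      MorphismProperty.pullback_fst (P := MorphismProperty.isomorphisms Scheme) _ _ ‹IsIso ι›
    exact hX'.of_iso (inv (pullback.fst π ι))

end Summit.ResolutionOfSingularities.ResolutionOfSingularities.Theorems

end
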